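import Summits.CriticalPhenomena.PercolationContinuityZ3.Theorems.PercLowPointHalfSpaceTallClusterMassBoundWallArmPartial
import Literature.Probability.Percolation.LatticeSymmetry

/-!
# `TallClusterMassBound` (stmt-CriticalPhenomena-0912), line `replica-overlap-cs-transfer` —
# a polynomial LOWER bound for the wall-to-axis two-point function at `p_c(ℤ³)`

For bond percolation on `ℤ³` at `p_c`, with `ℍ = {x₀ ≥ 0}` and `τ_ℍ(0,z) = P(0 ↔_ℍ z) = (Pp p_c).real (conn z)`:

  `τ_ℍ(0, (2(n+1), 0, 0)) ≥ 1 / (588² (n+1)⁴)`   (`wallAxis_twoPoint_ge`),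

i.e. the probability that the wall point `0` is joined inside the half-space to the point at height `2(n+1)`
straight above it decays at most like `height^{-4}`. Ingredients, all in tree:
(1) `φ_{p_c}(Λ_{n+1}) ≥ 1` (Duminil-Copin–Tassion; `one_le_phi_criticalProbI`) and `p_c < 1`, so by pigeonhole
ONE of the `≤ 588 (n+1)²` boundary terms `P(0 ↔ x in Λ_{n+1})` is `≥ 1/(588 (n+1)²)` (`exists_boundary_term_ge`);
(2) the face isomorphism of `QuantitativeBGN.Negative.ArmLowerBound` maps that term into a WALL-ROOTED connection
`τ_ℍ(0, z)` with `z` at height exactly `n+1` (`real_openConnIn_box_le_conn_face`);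
(3) horizontal reflections preserve `ℍ`, `0` and the measure (`real_conn_le_reflect`), so the mirror point
`z̄ = (z₀, −z₁, −z₂)` has `τ_ℍ(0, z̄) ≥ τ_ℍ(0, z)`;
(4) Harris–FKG supermultiplicativity of wall-rooted connections (`real_conn_mul_le_real_conn_add`, landed helper
file `…WallArmPartial`): `τ_ℍ(0, z + z̄) ≥ τ_ℍ(0,z) τ_ℍ(0,z̄)`, and `z + z̄ = (2(n+1), 0, 0)`.

Why it is recorded under this crux: by `Negative.density_ge_tau` the conditional density of an `r`-tall wall
cluster at a fixed vertex is at least `τ_ℍ(0,·)`, so along the normal axis it is `≥ c h^{-4}` at height `h` for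
every `r` — a floor under the density decay that `stub_topShellOverlap` / the crux must exhibit; and it bounds the
rate in the route's support item `HalfSpaceAxisDecay` (`τ_ℍ(0, L e₀) → 0`) from below by `L^{-4}`.
Also `real_conn_up_succ_ge` : one more step up costs at most the factor `p` (`τ_ℍ(0,(k+1)e₀) ≥ p τ_ℍ(0,k e₀)`),
which covers odd heights.
-/

noncomputable section

open MeasureTheory Finset Filter
open Literature.Probability.Percolation Literature.Probability.LatticeModels
open Summit.CriticalPhenomena.PercolationContinuityZ3.Theorems.TallClusterMassBound.Negative
open Summit.CriticalPhenomena.PercolationContinuityZ3.Theorems.QuantitativeBGN.Negative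

namespace Summit.CriticalPhenomena.PercolationContinuityZ3.Theorems.TallClusterMassBound.ReplicaOverlap

/-! ## (1) Pigeonhole on `φ_{p_c}(Λ_{n+1}) ≥ 1` -/

/-- `p_c(ℤ³) < 1`. [folklore] -/
theorem criticalProbI_lt_one : ((criticalProbI 3 : unitInterval) : ℝ) < 1 := by
  rw [coe_criticalProbI]; exact criticalProb_zd_lt_one (by norm_num)

/-- **One large boundary term**: at `p_c(ℤ³)` some boundary pair `x ∈ Λ_{n+1} ∌ y`, `x ∼ y`, has
`P(0 ↔ x in Λ_{n+1}) ≥ 1/(588 (n+1)²)`. Otherwise the `≤ 588 (n+1)²` terms (`sum_card_filter_le`) would sum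
to `≤ 1`, while `φ_{p_c}(Λ_{n+1}) = p_c · Σ ≥ 1` and `p_c < 1` force `Σ > 1`. [folklore] -/
theorem exists_boundary_term_ge (n : ℕ) :
    ∃ x ∈ box 3 (n + 1), ∃ y : V3, y ∉ box 3 (n + 1) ∧ (zdGraph 3).Adj x y ∧
      1 / (588 * ((n : ℝ) + 1) ^ 2) ≤ (Pp (criticalProbI 3)).real (openConnIn (↑(box 3 (n + 1))) 0 x) := by
  by_contra hcon
  push Not at hcon
  set κ : ℝ := 1 / (588 * ((n : ℝ) + 1) ^ 2) with hκ
  have hφ := one_le_phi_criticalProbI (d := 3) (by norm_num) (box 3 (n + 1)) (zero_mem_box 3 (n + 1))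
  rw [DCT16.phi_def] at hφ
  -- every term is < κ, so the double sum is ≤ κ · (number of boundary pairs) ≤ 1
  have hsum : ∑ x ∈ box 3 (n + 1), ∑ y ∈ (zdGraph 3).neighborFinset x with y ∉ box 3 (n + 1),
      (bondPercolation (zdGraph 3) (criticalProbI 3)).real (openConnIn (↑(box 3 (n + 1))) 0 x) ≤
      κ * ∑ x ∈ box 3 (n + 1), ((((zdGraph 3).neighborFinset x).filter (fun y => y ∉ box 3 (n + 1))).card : ℝ) := by
    rw [Finset.mul_sum]
    refine Finset.sum_le_sum fun x hx => ?_
    rw [mul_comm, ← nsmul_eq_mul, ← Finset.sum_const]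
    refine Finset.sum_le_sum fun y hy => ?_
    obtain ⟨hy1, hy2⟩ := Finset.mem_filter.1 hy
    exact (hcon x hx y hy2 ((SimpleGraph.mem_neighborFinset _ _ _).1 hy1)).le
  have hN := sum_card_filter_le n
  have hκ0 : 0 ≤ κ := by positivity
  have hpos : (0 : ℝ) < 588 * ((n : ℝ) + 1) ^ 2 := by positivity
  have hκN : κ * (588 * ((n : ℝ) + 1) ^ 2) = 1 := by
    rw [hκ]; field_simp
  have hS1 : ∑ x ∈ box 3 (n + 1), ∑ y ∈ (zdGraph 3).neighborFinset x with y ∉ box 3 (n + 1),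
      (bondPercolation (zdGraph 3) (criticalProbI 3)).real (openConnIn (↑(box 3 (n + 1))) 0 x) ≤ 1 := by
    calc _ ≤ κ * ∑ x ∈ box 3 (n + 1),
          ((((zdGraph 3).neighborFinset x).filter (fun y => y ∉ box 3 (n + 1))).card : ℝ) := hsum
      _ ≤ κ * (588 * ((n : ℝ) + 1) ^ 2) := mul_le_mul_of_nonneg_left hN hκ0
      _ = 1 := hκN
  have hp1 := criticalProbI_lt_one
  have hp0 : (0 : ℝ) ≤ (criticalProbI 3 : unitInterval) := (criticalProbI 3).2.1
  have hS0 : 0 ≤ ∑ x ∈ box 3 (n + 1), ∑ y ∈ (zdGraph 3).neighborFinset x with y ∉ box 3 (n + 1),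
      (bondPercolation (zdGraph 3) (criticalProbI 3)).real (openConnIn (↑(box 3 (n + 1))) 0 x) :=
    Finset.sum_nonneg fun _ _ => Finset.sum_nonneg fun _ _ => measureReal_nonneg
  -- 1 ≤ p_c · Σ ≤ p_c · 1 < 1
  have : (1 : ℝ) < 1 :=
    calc (1 : ℝ) ≤ _ := hφ
      _ ≤ ((criticalProbI 3 : unitInterval) : ℝ) * 1 := mul_le_mul_of_nonneg_left hS1 hp0
      _ < 1 := by rw [mul_one]; exact hp1
  exact lt_irrefl _ this

/-! ## (2) The face isomorphism keeps the endpoint: a wall-rooted connection to height exactly `n` -/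

/-- Endpoint-preserving form of `real_openConnIn_le_armH_of_iso`: if a lattice symmetry `g` maps `Λ_m`
into `ℍ` and `x` to `0`, then `P(0 ↔ x in Λ_m) ≤ P(0 ↔_ℍ g(0)) = τ_ℍ(0, g 0)`. [folklore] -/
theorem real_openConnIn_box_le_conn_of_iso (p : unitInterval) {m : ℕ} {x : V3}
    (g : zdGraph 3 ≃g zdGraph 3) (hH : ∀ z ∈ ((box 3 m : Finset V3) : Set V3), 0 ≤ g.toEquiv z 0)
    (hx : g.toEquiv x = 0) :
    (Pp p).real (openConnIn (↑(box 3 m)) 0 x) ≤ (Pp p).real (conn (g.toEquiv 0)) := by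
  rw [Pp, ← bondPercolation_real_preimage_relabel_iso g p (conn (g.toEquiv 0))]
  refine measureReal_mono fun ω hω => ?_
  rw [Set.mem_preimage]
  have hpath := (DCT16.mem_openConnIn_iff_pathIn.1 hω).symm
  have hmap := DCT16.pathIn_map (G' := openGraph (BondConfig.relabel (sym2Equiv g.toEquiv) ω))
    g.toEquiv (B := {z : Site 3 | 0 ≤ z 0}) hH
    (fun a b _ _ hab => (openGraph_relabel_adj_iff g.toEquiv ω a b).2 hab) hpath
  rw [hx] at hmap
  exact DCT16.mem_openConnIn_of_pathIn hmap

/-- **Boundary term ≤ wall-rooted connection to height `m`**: for a boundary pair `x ∈ Λ_m ∌ y`, `x ∼ y`,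
there is a point `z` with `z₀ = m` (and `z ∈ ℍ`) such that `P(0 ↔ x in Λ_m) ≤ τ_ℍ(0, z)` — the face
isomorphism `faceIso` of `ArmLowerBound` sends `x` to the wall point `0`, `Λ_m` into `ℍ`, and `0` to height `m`.
[folklore] -/
theorem real_openConnIn_box_le_conn_face (p : unitInterval) {m : ℕ} {x y : V3} (hx : x ∈ box 3 m)
    (hy : y ∉ box 3 m) (hxy : (zdGraph 3).Adj x y) :
    ∃ z : V3, z 0 = m ∧ (Pp p).real (openConnIn (↑(box 3 m)) 0 x) ≤ (Pp p).real (conn z) := by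
  obtain ⟨i, hi⟩ := exists_face_of_boundary_pair hx hy hxy
  obtain ⟨s, hs1, hs⟩ : ∃ s : ℤˣ, ((s : ℤ) = 1 ∨ (s : ℤ) = -1) ∧ (s : ℤ) * x i = -m := by
    rcases hi with h | h
    · exact ⟨-1, Or.inr (by simp), by rw [h]; simp⟩
    · exact ⟨1, Or.inl (by simp), by rw [h]; simp⟩
  refine ⟨(faceIso x i s).toEquiv 0, ?_, real_openConnIn_box_le_conn_of_iso p (faceIso x i s) ?_
    (faceIso_apply_self x i s)⟩
  · rw [faceIso_apply_zero]
    rcases hs1 with h1 | h1 <;> rw [h1] at hs ⊢ <;> simp <;> omega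
  · intro z hz
    rw [Finset.mem_coe, mem_box] at hz
    have hzi := hz i
    rw [faceIso_apply_zero]
    rcases hs1 with h1 | h1 <;> rw [h1] at hs ⊢ <;> omega

/-! ## (3) Horizontal reflections -/

/-- A horizontal reflection (`i ≠ 0`) maps `ℍ` into `ℍ`. [folklore] -/
theorem reflectIso_image_Hs_subset {i : Fin 3} (hi : i ≠ 0) :
    (reflectIso i).toEquiv '' Hs ⊆ Hs := by
  rintro _ ⟨a, ha, rfl⟩
  change (0 : ℤ) ≤ (reflectIso i).toEquiv a 0
  have h0 : (0 : ℤ) ≤ a 0 := ha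
  have : (reflectIso i).toEquiv a 0 = a 0 := reflectIso_apply_of_ne hi.symm a
  rw [this]; exact h0

/-- **Reflection monotonicity** (in fact invariance; one direction suffices here): for a horizontal
reflection `R = reflectIso i`, `i ≠ 0`, `τ_ℍ(0, z) ≤ τ_ℍ(0, R z)` — `R` fixes `0`, maps `ℍ` into `ℍ` and
preserves `P_p` (`bondPercolation_real_preimage_relabel_iso`). [folklore] -/
theorem real_conn_le_reflect (p : unitInterval) {i : Fin 3} (hi : i ≠ 0) (z : V3) :
    (Pp p).real (conn z) ≤ (Pp p).real (conn (reflectIso (d := 3) i z)) := by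
  rw [Pp, ← bondPercolation_real_preimage_relabel_iso (reflectIso (d := 3) i) p
    (conn (reflectIso (d := 3) i z))]
  refine measureReal_mono fun ω hω => ?_
  rw [Set.mem_preimage]
  have h := relabel_mem_openConnIn (reflectIso (d := 3) i).toEquiv (S := Hs) (x := 0) (y := z) hω
  have h0 : (reflectIso (d := 3) i).toEquiv 0 = 0 := by
    change Site.signedPerm _ _ 0 = 0
    funext j; simp [Site.signedPerm_apply]
  rw [h0] at h
  exact openConnIn_mono (reflectIso_image_Hs_subset hi) _ _ h

/-- The mirror point `z̄ = (z₀, −z₁, −z₂)`. [folklore] -/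
def mirror (z : V3) : V3 := reflectIso (d := 3) 1 (reflectIso (d := 3) 2 z)

/-- Coordinates of the mirror point. [folklore] -/
theorem mirror_apply (z : V3) : mirror z 0 = z 0 ∧ mirror z 1 = -z 1 ∧ mirror z 2 = -z 2 := by
  refine ⟨?_, ?_, ?_⟩
  · rw [mirror, reflectIso_apply_of_ne (show (0 : Fin 3) ≠ 1 by decide),
      reflectIso_apply_of_ne (show (0 : Fin 3) ≠ 2 by decide)]
  · rw [mirror, reflectIso_apply_same, reflectIso_apply_of_ne (show (1 : Fin 3) ≠ 2 by decide)]
  · rw [mirror, reflectIso_apply_of_ne (show (2 : Fin 3) ≠ 1 by decide), reflectIso_apply_same]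

/-- `τ_ℍ(0, z) ≤ τ_ℍ(0, z̄)`. [folklore] -/
theorem real_conn_le_mirror (p : unitInterval) (z : V3) :
    (Pp p).real (conn z) ≤ (Pp p).real (conn (mirror z)) :=
  (real_conn_le_reflect p (show (2 : Fin 3) ≠ 0 by decide) z).trans
    (real_conn_le_reflect p (show (1 : Fin 3) ≠ 0 by decide) _)

/-- `z + z̄ = (2m, 0, 0) = up (2m)` when `z₀ = m`. [folklore] -/
theorem add_mirror_eq_up {z : V3} {m : ℕ} (hz : z 0 = m) : z + mirror z = up (2 * m) := by
  obtain ⟨h0, h1, h2⟩ := mirror_apply z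
  funext j
  revert j
  rw [forall_fin3]
  refine ⟨?_, ?_, ?_⟩
  · show z 0 + mirror z 0 = up (2 * m) 0
    rw [h0, hz, up_apply_zero]; push_cast; ring
  · show z 1 + mirror z 1 = up (2 * m) 1
    rw [h1]; simp [up]
  · show z 2 + mirror z 2 = up (2 * m) 2
    rw [h2]; simp [up]

/-- The mirror of a point of `ℍ`... rather: a point with `z₀ = m ≥ 0` lies in `ℍ`. [folklore] -/
theorem mem_Hs_of_apply_zero {z : V3} {m : ℕ} (hz : z 0 = m) : z ∈ Hs := by
  change (0 : ℤ) ≤ z 0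
  rw [hz]; exact Int.natCast_nonneg m

/-! ## (4) The wall-to-axis two-point lower bound -/

/-- **Wall-to-axis two-point LOWER bound at `p_c(ℤ³)`**: `τ_ℍ(0, (2(n+1),0,0)) ≥ 1/(588² (n+1)⁴)`.
Pigeonhole term `≥ κ = 1/(588(n+1)²)` → wall-rooted `τ_ℍ(0,z) ≥ κ` with `z₀ = n+1` → mirror `τ_ℍ(0,z̄) ≥ κ` →
Harris–FKG `τ_ℍ(0, z + z̄) ≥ κ²` with `z + z̄ = (2(n+1),0,0)`. [folklore] -/
theorem wallAxis_twoPoint_ge (n : ℕ) :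
    1 / (588 ^ 2 * ((n : ℝ) + 1) ^ 4) ≤ (Pp (criticalProbI 3)).real (conn (up (2 * (n + 1)))) := by
  set p : unitInterval := criticalProbI 3 with hp
  obtain ⟨x, hx, y, hy, hxy, hterm⟩ := exists_boundary_term_ge n
  obtain ⟨z, hz0, hzle⟩ := real_openConnIn_box_le_conn_face p hx hy hxy
  have hz0' : z 0 = ((n + 1 : ℕ) : ℤ) := by rw [hz0]
  have hzH : z ∈ Hs := mem_Hs_of_apply_zero hz0'
  have hκz : 1 / (588 * ((n : ℝ) + 1) ^ 2) ≤ (Pp p).real (conn z) := hterm.trans hzle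
  have hκz' : 1 / (588 * ((n : ℝ) + 1) ^ 2) ≤ (Pp p).real (conn (mirror z)) :=
    hκz.trans (real_conn_le_mirror p z)
  have hglue := real_conn_mul_le_real_conn_add p hzH (mirror z)
  rw [add_mirror_eq_up hz0'] at hglue
  have hκ0 : (0 : ℝ) ≤ 1 / (588 * ((n : ℝ) + 1) ^ 2) := by positivity
  calc 1 / (588 ^ 2 * ((n : ℝ) + 1) ^ 4)
      = (1 / (588 * ((n : ℝ) + 1) ^ 2)) * (1 / (588 * ((n : ℝ) + 1) ^ 2)) := by
        rw [div_mul_div_comm, one_mul]; ring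
    _ ≤ (Pp p).real (conn z) * (Pp p).real (conn (mirror z)) :=
        mul_le_mul hκz hκz' hκ0 measureReal_nonneg
    _ ≤ (Pp p).real (conn (up (2 * (n + 1)))) := hglue

/-- The single edge `{k e₀, (k+1) e₀}` as a one-element edge set. [folklore] -/
def upEdge (k : ℕ) : Finset (Sym2 V3) := {s(up k, up (k + 1))}

/-- **One step up costs at most a factor `p`**: `p · τ_ℍ(0, k e₀) ≤ τ_ℍ(0, (k+1) e₀)` — glue the open edge
`{k e₀, (k+1) e₀}` (probability `p`, increasing) to `{0 ↔_ℍ k e₀}` by Harris–FKG. Covers odd heights. [folklore] -/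
theorem real_conn_up_succ_ge (p : unitInterval) (k : ℕ) :
    (p : ℝ) * (Pp p).real (conn (up k)) ≤ (Pp p).real (conn (up (k + 1))) := by
  -- the single-edge event
  set E : Set (BondConfig V3) := {ω | (↑(upEdge k) : Set (Sym2 V3)) ⊆ ω} with hE
  have hEdges : (↑(upEdge k) : Set (Sym2 V3)) ⊆ (zdGraph 3).edgeSet := by
    intro e he
    rw [Finset.mem_coe, upEdge, Finset.mem_singleton] at he
    subst he
    exact (SimpleGraph.mem_edgeSet _).2 (adj_up_succ k)
  have hPE : (Pp p).real E = p := by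
    have h := bondPercolation_real_setOf_subset (zdGraph 3) p (upEdge k) hEdges
    rw [upEdge, Finset.card_singleton, pow_one] at h
    rw [← h]; rfl
  have hEup : IsUpperSet E := fun ω ω' hle hω => Set.Subset.trans hω hle
  have hEmeas : MeasurableSet E := by
    have : E = {ω | s(up k, up (k + 1)) ∈ ω} := by
      ext ω; simp [hE, upEdge]
    rw [this]
    exact measurableSet_mem _
  have hsub : conn (up k) ∩ E ⊆ conn (up (k + 1)) := by
    rintro ω ⟨hω, hωE⟩
    have he : s(up k, up (k + 1)) ∈ ω := hωE (by simp [upEdge])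
    rw [mem_conn_iff] at hω ⊢
    refine hω.trans (SimpleGraph.Adj.reachable ?_)
    have hne : up k ≠ up (k + 1) := (adj_up_succ k).ne
    rw [SimpleGraph.inf_adj, openGraph_adj, withinGraph_adj, SimpleGraph.top_adj]
    exact ⟨⟨he, hne⟩, hne, up_mem_Hs k, up_mem_Hs (k + 1)⟩
  calc (p : ℝ) * (Pp p).real (conn (up k)) = (Pp p).real (conn (up k)) * (Pp p).real E := by
        rw [hPE, mul_comm]
    _ ≤ (Pp p).real (conn (up k) ∩ E) :=
        harris_fkg_holds (zdGraph 3) p (isUpperSet_conn (up k)) hEup (measurableSet_conn (up k)) hEmeas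
    _ ≤ (Pp p).real (conn (up (k + 1))) := measureReal_mono hsub

/-- **Registered form** (binder-free) of the wall-to-axis lower bound. [folklore] -/
theorem wallAxis_twoPoint_lower :
    ∀ n : ℕ, 1 / (588 ^ 2 * ((n : ℝ) + 1) ^ 4) ≤ (Pp (criticalProbI 3)).real (conn (up (2 * (n + 1)))) :=
  wallAxis_twoPoint_ge

end Summit.CriticalPhenomena.PercolationContinuityZ3.Theorems.TallClusterMassBound.ReplicaOverlap
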